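import Literature.Topology.PlanarFoliations.LeafLoop
import Literature.Topology.PlanarFoliations.LeafOrder
import Literature.Topology.FourManifolds.TautFoliationsSuspensionCollar
import HarnessLib

/-!
# Stability of compact leaves of planar foliations: the band of closed leaves around a compact leaf with trivial holonomy

Topic: Topology / PlanarFoliations. Let `F : Foliation ℝ X` be a bi-oriented, transversely
oriented planar foliation (`BiOrient.lean`), `K` a compact leaf parametrised by an injective
leaf loop `γ` (`LeafLoop.lean`), `x₀ = γ 0` and `e₀ ∋ x₀` a flow box, with vertical
`V τ = e₀.symm (b₀, τ)` through `x₀`. If the **holonomy of `K` along `γ` is trivial**, the fence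
over `γ` with matched ends of `TautFoliationsSuspensionCollar.lean` *closes up*: its
horizontal of level `τ` is a leaf path `h_τ` from `V τ` back to `V τ`
(`exists_closedFence`, packaged as `ClosedFence`). The main result of this file
(`isCompact_leaf_of_sides`, `ClosedFence.exists_forall_isCompact_leaf`) is the **local
stability theorem in the plane**: for `τ`
near `h_{e₀}(x₀)` **the leaf through `V τ` is compact** — the one-parameter family of closed
leaves around a closed orbit with trivial holonomy (Camacho–Lins Neto, *Geometric Theory of
Foliations*, Ch. IV §2 Thm. 3 (local stability of compact leaves with finite holonomy), used
in Ch. VII §2 Prop. 1 in the form "a closed orbit of the induced foliation of the disc whose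
image is homotopic to a constant in its leaf has a cylindrical neighbourhood of closed
orbits"; Hector–Hirsch, *Introduction to the Geometry of Foliations, Part A*, Ch. III 2.1.8).

The fence horizontals need not be injective (their leaf coordinates are arbitrary continuous
functions), so the compactness of the nearby leaves is proved by an **order argument** rather
than by exhibiting injective loops: if the leaf `L_τ` of `V τ` were not compact it would carry
the linear order `leafLT` of `LeafOrder.lean`; the loop `h_τ : p ⟶ p` (`p = V τ`) is uniformly
close to `γ`, so on a middle parameter interval `J = [θ₁, 1 - θ₁]` it avoids `p`, while at
`θ₁` and `1 - θ₁` it lies on the plaque of `p` on *opposite sides* of `p` (as `γ` does, being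
injective near `x₀`) — i.e. once after and once before `p` in the leaf order; the connected
`J` would then be covered by the two disjoint open sets `{h_τ > p}`, `{h_τ < p}`, meeting both.

* `exists_localDatum_height`, `exists_nhds_forall_mem_plaque` (**proved**, any leaf model): a
  fence levels in the box `e` itself, uniformly near a parameter at which the family of germs
  is the germ of `h_e` — near the two ends of a closed fence the horizontals run on the
  plaques of `e₀`.
* `loopBase`, `loopPath` (**definitions**): a leaf loop `ℝ → F.Leaf x` as a path of `X` at
  its base point; `baseLevel`, `baseCoord`, `vert` (**definitions**): the level and leaf
  coordinate of the base point in `e₀`, and the vertical of `e₀` through it.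
* `ClosedFence γ e₀` (**structure**) and `exists_closedFence` (**proved**): trivial holonomy
  along `γ` ⇒ a closed fence over `γ`.
* `mul_neg_of_injective_ends` (**proved**): the two ends of an injective loop leave its base
  point on opposite sides of the plaque (real intermediate value theorem).
* `ClosedFence.exists_constants` (**proved**): the constants `θ₁, sg, δ` of the order argument
  (plaque membership near the ends, avoidance of `V τ` on the middle interval, opposite
  sides), uniformly for `τ` in a level interval.
* `isCompact_leaf_of_sides` (**proved**): the order argument for one level.
* `ClosedFence.exists_forall_isCompact_leaf` (**proved**): the stability theorem.

## References

* C. Camacho, A. Lins Neto, *Geometric Theory of Foliations*, Birkhäuser (1985), Ch. IV §2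
  Thm. 3, Ch. VII §2 Prop. 1 [CamachoLinsNeto1985].
* G. Hector, U. Hirsch, *Introduction to the Geometry of Foliations, Part A*, 2nd ed., Vieweg
  (1986), Ch. III 2.1.8 [HectorHirsch1986].
-/

noncomputable section

open Set Filter Function
open _root_.Topology unitInterval
open Literature.Topology.FourManifolds Literature.Topology.FourManifolds.Foliation

namespace Literature.Topology.PlanarFoliations

/-! ## Fences level in the box of their initial germ -/

section FenceHeight

variable {B : Type*} [NormedAddCommGroup B] [Nonempty B] [LocallyConnectedSpace B]
  {M : Type*} [TopologicalSpace M] {F : Foliation B M}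
  {A : Type*} [TopologicalSpace A] {e : OpenPartialHomeomorph M (B × ℝ)}

/-- **A local datum in the box of the germ.** If at `a₀` the continuous family of germs `Γ`
is the germ of the distinguished map `h_e` itself, then near `a₀` it is the germ of `h_e` at
its base points (the homeomorphism germ of the local product structure is the identity), and
`(e, id, id)` is a local datum for `Γ` near `a₀`, of any level radius. [folklore] -/
theorem exists_localDatum_height (Γ : C(A, F.GermSpace)) {a₀ : A} (he : e ∈ F.atlas)
    {q : F.LeafSpace} (hq : ofLeafSpace q ∈ e.source) (hΓ : Γ a₀ = GermSpace.ofHeight F he q hq)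
    (ε : ℝ) :
    ∃ U ∈ 𝓝 a₀, ∃ D : LocalDatum F Γ (e (ofLeafSpace q)).2 ε U, D.box = e ∧ D.ψ = id := by
  have hsrc : ofLeafSpace (Γ a₀).pt ∈ e.source := by rw [hΓ]; exact hq
  obtain ⟨χ, hχ, U, hU, H⟩ := F.exists_nhds_forall_eq_germSection Γ a₀ he hsrc
  have ht : (e (ofLeafSpace (Γ a₀).pt)).2 = (e (ofLeafSpace q)).2 := by rw [hΓ]; rfl
  generalize (e (ofLeafSpace (Γ a₀).pt)).2 = t at hχ H ht
  subst ht
  -- `χ = id` near the level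
  have hχid : χ =ᶠ[𝓝 (e (ofLeafSpace q)).2] id := by
    obtain ⟨h0, hG⟩ := H a₀ (mem_of_mem_nhds hU)
    have h1 : (Γ a₀).germ = ↑(χ ∘ height e) := by rw [hG, germSection_germ]
    rw [hΓ, GermSpace.ofHeight_germ] at h1
    have h2 : (↑(id ∘ height e) : Germ (𝓝 (ofLeafSpace q)) ℝ) = ↑(χ ∘ height e) := h1
    exact (F.eventuallyEq_of_comp_height_eq he hq h2).symm
  refine ⟨U, hU, ⟨e, he, id, id, fun a ha ↦ ?_, fun a ha ↦ (H a ha).1, fun τ _ ↦ rfl,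
    Eventually.of_forall fun r ↦ rfl, continuousOn_id, injOn_id _⟩, rfl, rfl⟩
  obtain ⟨hpl, hG⟩ := H a ha
  rw [hG, germSection_germ, Germ.coe_eq]
  have hT : Tendsto (height e) (𝓝 (ofLeafSpace (F.leafPlaqueMap e (e (ofLeafSpace q)).2
      (e (ofLeafSpace (Γ a).pt)).1))) (𝓝 (e (ofLeafSpace q)).2) := by
    have h := tendsto_height (e := e) (F.plaqueMap_mem_source he (e (ofLeafSpace q)).2
      (e (ofLeafSpace (Γ a).pt)).1)
    rwa [F.apply_plaqueMap he] at h
  exact hχid.comp_tendsto hT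

/-- **Near a parameter at which the family of germs is the germ of `h_e`, a fence over the
whole (locally compact) parameter space runs, level by level, on the plaques of `e`**: there
are a neighbourhood `U` of `a₀` and a level radius `δ` with `Φ a τ ∈ plaque e τ` for `a ∈ U`
and `|τ - τ₀| < δ` (uniform consistency of the fence with the datum `(e, id, id)` on a
compact neighbourhood). [folklore] -/
theorem exists_nhds_forall_mem_plaque [LocallyCompactSpace A] (Γ : C(A, F.GermSpace)) {a₀ : A}
    (he : e ∈ F.atlas) {q : F.LeafSpace} (hq : ofLeafSpace q ∈ e.source)
    (hΓ : Γ a₀ = GermSpace.ofHeight F he q hq) {ε : ℝ} (hε : 0 < ε) {Φ : A → ℝ → M}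
    (hΦ : IsFenceOn F Γ (e (ofLeafSpace q)).2 ε Φ univ) :
    ∃ U ∈ 𝓝 a₀, ∃ δ > (0 : ℝ), δ ≤ ε ∧ ∀ a ∈ U,
      ∀ τ ∈ Ioo ((e (ofLeafSpace q)).2 - δ) ((e (ofLeafSpace q)).2 + δ), Φ a τ ∈ plaque e τ := by
  obtain ⟨U, hU, D, hDe, hDψ⟩ := exists_localDatum_height Γ he hq hΓ ε
  obtain ⟨C, hC, hCU, hCc⟩ := local_compact_nhds hU
  obtain ⟨δ, hδ, hδε, hlev⟩ := hΦ.exists_forall_level isOpen_univ hε D hCc (subset_univ _) hCU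
  refine ⟨C, hC, δ, hδ, hδε, fun a ha τ hτ ↦ ?_⟩
  obtain ⟨h₁, h₂⟩ := hlev a ha τ hτ
  rw [hDe] at h₁ h₂
  rw [hDψ] at h₂
  exact ⟨h₁, h₂⟩

end FenceHeight

/-! ## Leaf loops as paths; the closed fence over a compact leaf with trivial holonomy -/

variable {X : Type*} [TopologicalSpace X] {F : Foliation ℝ X} {x : X}

/-- The base point in `X` of a leaf loop `γ : ℝ → F.Leaf x`. [folklore] -/
def loopBase (γ : ℝ → F.Leaf x) : X := ofLeafSpace ((γ 0 : F.Leaf x) : F.LeafSpace)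

/-- The base point lies on the leaf. [folklore] -/
theorem loopBase_mem_leaf (γ : ℝ → F.Leaf x) : loopBase γ ∈ F.leaf x := (γ 0).2

/-- A leaf loop `γ : ℝ → F.Leaf x` (continuous in the leaf topology, `1`-periodic) as a path of
`X` at its base point `γ 0`. [folklore] -/
def loopPath (γ : ℝ → F.Leaf x) (hγ : Continuous γ) (hp : Periodic γ 1) :
    Path (loopBase γ) (loopBase γ) where
  toFun θ := ofLeafSpace ((γ θ : F.Leaf x) : F.LeafSpace)
  continuous_toFun := F.continuous_ofLeafSpace.comp
    (continuous_subtype_val.comp (hγ.comp continuous_subtype_val))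
  source' := rfl
  target' := by
    show ofLeafSpace ((γ (1 : ℝ) : F.Leaf x) : F.LeafSpace) = ofLeafSpace ((γ 0 : F.Leaf x) : F.LeafSpace)
    rw [show (1 : ℝ) = 0 + 1 by ring, hp 0]

/-- The values of `loopPath`. [folklore] -/
@[simp] theorem loopPath_apply (γ : ℝ → F.Leaf x) (hγ : Continuous γ) (hp : Periodic γ 1) (θ : I) :
    loopPath γ hγ hp θ = ofLeafSpace ((γ θ : F.Leaf x) : F.LeafSpace) := rfl

/-- `loopPath` is continuous in the leaf topology. [folklore] -/
theorem continuous_toLeafSpace_loopPath (γ : ℝ → F.Leaf x) (hγ : Continuous γ) (hp : Periodic γ 1) :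
    Continuous (toLeafSpace ∘ loopPath γ hγ hp : I → F.LeafSpace) :=
  continuous_subtype_val.comp (hγ.comp continuous_subtype_val)

/-- The points of `loopPath` lie on the leaf `F.leaf x`. [folklore] -/
theorem loopPath_mem_leaf (γ : ℝ → F.Leaf x) (hγ : Continuous γ) (hp : Periodic γ 1) (θ : I) :
    loopPath γ hγ hp θ ∈ F.leaf x := (γ θ).2

/-- **`loopPath` is injective away from the end point**: for `θ, θ' ∈ [0, 1)` (as points of
`I`), equal values force `θ = θ'`, when `γ` is injective on `[0, 1)`. [folklore] -/
theorem loopPath_injOn (γ : ℝ → F.Leaf x) (hγ : Continuous γ) (hp : Periodic γ 1)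
    (hinj : InjOn γ (Ico 0 1)) {θ θ' : I} (hθ : (θ : ℝ) < 1) (hθ' : (θ' : ℝ) < 1)
    (h : loopPath γ hγ hp θ = loopPath γ hγ hp θ') : θ = θ' := by
  have h' : γ θ = γ θ' := Subtype.ext ((ofLeafSpace (F := F)).injective h)
  exact Subtype.ext (hinj ⟨θ.2.1, hθ⟩ ⟨θ'.2.1, hθ'⟩ h')

/-- A value of `loopPath` at `θ ∈ (0, 1)` is not the base point. [folklore] -/
theorem loopPath_ne_base (γ : ℝ → F.Leaf x) (hγ : Continuous γ) (hp : Periodic γ 1)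
    (hinj : InjOn γ (Ico 0 1)) {θ : I} (h₀ : 0 < (θ : ℝ)) (h₁ : (θ : ℝ) < 1) :
    loopPath γ hγ hp θ ≠ loopPath γ hγ hp 0 := fun h ↦ by
  have := loopPath_injOn γ hγ hp hinj h₁ (by norm_num) h
  rw [this] at h₀
  exact lt_irrefl _ h₀

/-- `loopPath` at `0` is the base point. [folklore] -/
@[simp] theorem loopPath_zero (γ : ℝ → F.Leaf x) (hγ : Continuous γ) (hp : Periodic γ 1) :
    loopPath γ hγ hp 0 = loopBase γ := rfl

/-! ## Closed fences over injective leaf loops -/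

section ClosedFence

variable (γ : ℝ → F.Leaf x) (e₀ : OpenPartialHomeomorph X (ℝ × ℝ))

/-- The base level `τ₀ = h_{e₀}(γ 0)`. [folklore] -/
def baseLevel : ℝ := (e₀ (loopBase γ)).2

/-- The leaf coordinate `b₀` of the base point in `e₀`. [folklore] -/
def baseCoord : ℝ := (e₀ (loopBase γ)).1

/-- The vertical `V τ = e₀.symm (b₀, τ)` of `e₀` through the base point. [folklore] -/
def vert (τ : ℝ) : X := e₀.symm (baseCoord γ e₀, τ)

variable {γ e₀}

/-- Unfolding lemma for `baseLevel`. [folklore] -/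
theorem baseLevel_def : baseLevel γ e₀ = (e₀ (loopBase γ)).2 := rfl

/-- Unfolding lemma for `baseCoord`. [folklore] -/
theorem baseCoord_def : baseCoord γ e₀ = (e₀ (loopBase γ)).1 := rfl

/-- Unfolding lemma for `vert`. [folklore] -/
theorem vert_def (τ : ℝ) : vert γ e₀ τ = e₀.symm (baseCoord γ e₀, τ) := rfl

/-- The vertical at the base level is the base point. [folklore] -/
theorem vert_baseLevel (hx₀ : loopBase γ ∈ e₀.source) : vert γ e₀ (baseLevel γ e₀) = loopBase γ := by
  rw [vert_def, baseCoord_def, baseLevel_def, Prod.mk.eta, e₀.left_inv hx₀]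

/-- The vertical runs on the plaques of `e₀`. [folklore] -/
theorem vert_mem_plaque (he₀ : e₀ ∈ F.atlas) (τ : ℝ) : vert γ e₀ τ ∈ plaque e₀ τ :=
  symm_mem_plaque F he₀ _ _

/-- The coordinates of the vertical. [folklore] -/
theorem apply_vert (he₀ : e₀ ∈ F.atlas) (τ : ℝ) : e₀ (vert γ e₀ τ) = (baseCoord γ e₀, τ) :=
  e₀.right_inv (mk_mem_target F he₀ _ _)

/-- The vertical is continuous. [folklore] -/
theorem continuous_vert (he₀ : e₀ ∈ F.atlas) : Continuous (vert γ e₀) :=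
  (continuous_symm_of_mem F he₀).comp (continuous_const.prodMk continuous_id)

variable (γ e₀) in
/-- **A closed fence over an injective leaf loop.** The data produced by the fence with
matched ends over a leaf loop `γ` of trivial holonomy (`exists_closedFence`): `γ` continuous,
`1`-periodic and injective on `[0, 1)`, a flow box `e₀ ∋ γ 0` of the atlas, a level radius
`ε > 0`, the lift `Γ` of the loop to the germ space — equal to the germ of `h_{e₀}` at *both*
ends — and a fence `Φ` over the whole parameter interval whose two end verticals are the
vertical `V τ = e₀.symm (b₀, τ)` of `e₀` through `γ 0`: every horizontal `θ ↦ Φ θ τ` is a leaf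
path from `V τ` back to `V τ`. [folklore] -/
structure ClosedFence where
  /-- The loop is continuous in the leaf topology. -/
  cont : Continuous γ
  /-- The loop is `1`-periodic. -/
  per : Periodic γ 1
  /-- The loop is injective on a period. -/
  inj : InjOn γ (Ico 0 1)
  /-- The box belongs to the atlas. -/
  box_mem : e₀ ∈ F.atlas
  /-- The base point lies in the box. -/
  base_mem : loopBase γ ∈ e₀.source
  /-- The level radius. -/
  ε : ℝ
  /-- The level radius is positive. -/
  ε_pos : 0 < ε
  /-- The lift of the loop to the germ space. -/
  Γ : C(I, F.GermSpace)
  /-- The fence. -/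
  Φ : I → ℝ → X
  /-- `Γ` lifts the leaf loop. -/
  proj_comp : GermSpace.proj ∘ Γ =
    F.leafLoop (loopPath γ cont per) (continuous_toLeafSpace_loopPath γ cont per)
  /-- `Γ` starts at the germ of `h_{e₀}`. -/
  apply_zero : Γ 0 = GermSpace.ofHeight F box_mem ((γ 0 : F.Leaf x) : F.LeafSpace) base_mem
  /-- `Γ` ends at the germ of `h_{e₀}` (trivial holonomy). -/
  apply_one : Γ 1 = GermSpace.ofHeight F box_mem ((γ 0 : F.Leaf x) : F.LeafSpace) base_mem
  /-- `Φ` is a fence for `Γ` at the level of the base point. -/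
  isFenceOn : IsFenceOn F Γ (baseLevel γ e₀) ε Φ univ
  /-- The left end vertical is the vertical of `e₀` through the base point. -/
  left_end : ∀ τ ∈ Ioo (baseLevel γ e₀ - ε) (baseLevel γ e₀ + ε), Φ 0 τ = vert γ e₀ τ
  /-- The right end vertical is the vertical of `e₀` through the base point. -/
  right_end : ∀ τ ∈ Ioo (baseLevel γ e₀ - ε) (baseLevel γ e₀ + ε), Φ 1 τ = vert γ e₀ τ

namespace ClosedFence

variable (C : ClosedFence γ e₀)

/-- The base level lies in the level interval. [folklore] -/
theorem baseLevel_mem_Ioo : baseLevel γ e₀ ∈ Ioo (baseLevel γ e₀ - C.ε) (baseLevel γ e₀ + C.ε) :=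
  ⟨by linarith [C.ε_pos], by linarith [C.ε_pos]⟩

/-- **At the base level the fence is the loop.** [folklore] -/
theorem Φ_baseLevel (θ : I) : C.Φ θ (baseLevel γ e₀) = loopPath γ C.cont C.per θ := by
  rw [C.isFenceOn.base θ (mem_univ θ)]
  exact congrArg ofLeafSpace (congr_fun C.proj_comp θ)

/-- The left end of the fence. [folklore] -/
theorem Φ_zero {τ : ℝ} (hτ : τ ∈ Ioo (baseLevel γ e₀ - C.ε) (baseLevel γ e₀ + C.ε)) :
    C.Φ 0 τ = vert γ e₀ τ := C.left_end τ hτ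

/-- The right end of the fence. [folklore] -/
theorem Φ_one {τ : ℝ} (hτ : τ ∈ Ioo (baseLevel γ e₀ - C.ε) (baseLevel γ e₀ + C.ε)) :
    C.Φ 1 τ = vert γ e₀ τ := C.right_end τ hτ

/-- **The horizontals run in the leaves of the points of the vertical.** [folklore] -/
theorem Φ_mem_leaf {τ : ℝ} (hτ : τ ∈ Ioo (baseLevel γ e₀ - C.ε) (baseLevel γ e₀ + C.ε)) (θ : I) :
    C.Φ θ τ ∈ F.leaf (vert γ e₀ τ) := by
  rw [← C.Φ_zero hτ]
  exact C.isFenceOn.mem_leaf hτ 0 θ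

/-- The horizontals are leaf paths. [folklore] -/
theorem continuous_toLeafSpace_Φ {τ : ℝ} (hτ : τ ∈ Ioo (baseLevel γ e₀ - C.ε) (baseLevel γ e₀ + C.ε)) :
    Continuous (toLeafSpace ∘ fun θ ↦ C.Φ θ τ : I → F.LeafSpace) :=
  C.isFenceOn.continuous_toLeafSpace hτ

/-- The verticals are continuous at the base level. [folklore] -/
theorem continuousAt_Φ (θ : I) : ContinuousAt (C.Φ θ) (baseLevel γ e₀) :=
  (C.isFenceOn.continuousOn_apply isOpen_univ (mem_univ θ)).continuousAt
    (Ioo_mem_nhds C.baseLevel_mem_Ioo.1 C.baseLevel_mem_Ioo.2)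

/-- The fence is jointly continuous at the points of the base level. [folklore] -/
theorem continuousAt_uncurry_Φ (θ : I) : ContinuousAt (uncurry C.Φ) (θ, baseLevel γ e₀) :=
  C.isFenceOn.continuousAt isOpen_univ (mem_univ θ) C.baseLevel_mem_Ioo

end ClosedFence

/-- **A compact leaf with trivial holonomy along its loop carries a closed fence.** For a
transversely oriented foliation, an injective leaf loop `γ`, a flow box `e₀ ∋ γ 0` of the atlas
and trivial holonomy of the loop read in `e₀`, the fence with matched ends over `γ`
(`IsTransverselyOriented.exists_suspensionFence`) closes up on a smaller level interval: its
return map `ψ₁`, inverse of a representative of the holonomy germ `id`, is the identity near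
the base level (Camacho–Lins Neto, Ch. IV §2, Thm. 3, first step). [cite: CamachoLinsNeto1985, Ch. IV §2 Thm. 3] -/
theorem exists_closedFence (ho : F.IsTransverselyOriented) (hγ : Continuous γ) (hp : Periodic γ 1)
    (hinj : InjOn γ (Ico 0 1)) (he₀ : e₀ ∈ F.atlas) (hx₀ : loopBase γ ∈ e₀.source)
    (hhol : F.holonomyGerm he₀ hx₀ (Path.Homotopic.Quotient.mk
      (F.leafLoop (loopPath γ hγ hp) (continuous_toLeafSpace_loopPath γ hγ hp))) he₀ hx₀ =
        ↑(id : ℝ → ℝ)) :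
    Nonempty (ClosedFence γ e₀) := by
  obtain ⟨ε, φ₁, ψ₁, Γ, Φ, hε, -, -, -, -, -, -, hinv, hhol', hΓ, hΓ0, hΦ, h0, h1⟩ :=
    ho.exists_suspensionFence (loopPath γ hγ hp) (continuous_toLeafSpace_loopPath γ hγ hp) he₀ hx₀
  -- `φ₁ = id` and `ψ₁ = id` near `τ₀`
  have hφid : φ₁ =ᶠ[𝓝 (baseLevel γ e₀)] id := Germ.coe_eq.1 (hhol'.symm.trans hhol)
  have hIoo : Ioo (baseLevel γ e₀ - ε) (baseLevel γ e₀ + ε) ∈ 𝓝 (baseLevel γ e₀) :=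
    Ioo_mem_nhds (by linarith) (by linarith)
  have hψid : ∀ᶠ τ in 𝓝 (baseLevel γ e₀), ψ₁ τ = τ := by
    filter_upwards [hφid, hIoo] with τ h₁ h₂
    have h := (hinv τ h₂).1
    rwa [show φ₁ τ = τ from h₁] at h
  obtain ⟨δ, hδ, hδsub⟩ := IsHomeoGermAt.exists_Ioo_subset_of_mem_nhds (inter_mem hψid hIoo)
  -- `Γ 1` is the germ of `h_{e₀}`
  set L := F.leafLoop (loopPath γ hγ hp) (continuous_toLeafSpace_loopPath γ hγ hp) with hL
  have hlift : Γ = (F.isCoveringMap_proj).liftPath L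
      (GermSpace.ofHeight F he₀ ((γ 0 : F.Leaf x) : F.LeafSpace) hx₀) L.source := by
    rw [(F.isCoveringMap_proj).eq_liftPath_iff']
    exact ⟨hΓ, hΓ0⟩
  have hcont : Γ 1 = F.continuation he₀ hx₀ (Path.Homotopic.Quotient.mk L) :=
    (congr_fun (congrArg DFunLike.coe hlift) 1).trans (F.continuation_mk he₀ hx₀ L).symm
  have hhol₂ : F.holonomyGerm he₀ hx₀ (Path.Homotopic.Quotient.mk L) he₀ hx₀ = ↑(id : ℝ → ℝ) := hhol
  have hw := F.writeGerm_holonomyGerm he₀ hx₀ (Path.Homotopic.Quotient.mk L) he₀ hx₀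
  rw [hhol₂, writeGerm_coe] at hw
  have hΓ1 : Γ 1 = GermSpace.ofHeight F he₀ ((γ 0 : F.Leaf x) : F.LeafSpace) hx₀ := by
    rw [hcont]
    refine GermSpace.ext_heq (F.continuation_pt he₀ hx₀ _) ?_
    rw [← hw, id_comp]
    exact GermSpace.coe_germ_heq (congrArg ofLeafSpace (F.continuation_pt he₀ hx₀ _)) _
  have hIδ : Ioo (baseLevel γ e₀ - δ) (baseLevel γ e₀ + δ) ⊆ Ioo (baseLevel γ e₀ - ε) (baseLevel γ e₀ + ε) :=
    fun τ hτ ↦ (hδsub hτ).2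
  have hδε : δ ≤ ε := by
    by_contra h
    have hmem : baseLevel γ e₀ + ε ∈ Ioo (baseLevel γ e₀ - δ) (baseLevel γ e₀ + δ) :=
      ⟨by linarith, by linarith [not_le.1 h]⟩
    exact lt_irrefl _ (hIδ hmem).2
  refine ⟨⟨hγ, hp, hinj, he₀, hx₀, δ, hδ, Γ, Φ, hΓ, hΓ0, hΓ1, hΦ.mono Subset.rfl hδε,
    fun τ hτ ↦ h0 τ (hIδ hτ), fun τ hτ ↦ ?_⟩⟩
  rw [h1 τ (hIδ hτ), (hδsub hτ).1]
  rfl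

end ClosedFence

/-! ## The order argument: nearby leaves are compact -/

section Order

variable {γ : ℝ → F.Leaf x} {e₀ : OpenPartialHomeomorph X (ℝ × ℝ)}

/-- The leaf of `y`, as a subset of `X`, is the range of the inclusion of `F.Leaf y`. [folklore] -/
theorem leaf_eq_range_coe (y : X) :
    F.leaf y = range fun p : F.Leaf y ↦ ofLeafSpace (p : F.LeafSpace) := by
  ext z
  constructor
  · intro hz
    exact ⟨Leaf.mk z hz, rfl⟩
  · rintro ⟨p, rfl⟩
    exact p.2

/-- A leaf which is not compact is a noncompact space in its leaf topology. [folklore] -/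
theorem noncompactSpace_leaf_of_not_isCompact {y : X} (h : ¬ IsCompact (F.leaf y)) :
    NoncompactSpace (F.Leaf y) := by
  refine not_compactSpace_iff.1 fun hc ↦ h ?_
  rw [leaf_eq_range_coe]
  exact isCompact_range (Leaf.continuous_coe F y)

/-- **The order argument.** Let `C` be a closed fence over the injective leaf loop `γ`, `τ` a
level, `p = V τ`, and suppose that at two parameters `θa, θb` the horizontal `h_τ = Φ(·, τ)`
lies on the plaque of `e₀` through `p`, *after* `p` at `θa` and *before* `p` at `θb` (leaf
coordinate larger, resp. smaller, than `b₀`), while between `θa` and `θb` it avoids `p`. Then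
**the leaf of `p` is compact**: otherwise it is an open leaf, linearly ordered by `leafLT`
(`LeafOrder.lean`) with the plaque coordinate increasing (`leafArc_lt_iff`), and the connected
parameter interval between `θa` and `θb` would be covered by the disjoint open sets
`{h_τ > p}` and `{h_τ < p}`, meeting both. [folklore] -/
theorem isCompact_leaf_of_sides [T2Space X] [SecondCountableTopology X] (hbi : IsBiOriented F)
    (C : ClosedFence γ e₀) {τ : ℝ}
    (hτ : τ ∈ Ioo (baseLevel γ e₀ - C.ε) (baseLevel γ e₀ + C.ε)) {θa θb : I}
    (ha : C.Φ θa τ ∈ plaque e₀ τ) (hb : C.Φ θb τ ∈ plaque e₀ τ)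
    (hav : ∀ θ ∈ uIcc θa θb, C.Φ θ τ ≠ vert γ e₀ τ)
    (hgt : baseCoord γ e₀ < (e₀ (C.Φ θa τ)).1) (hlt : (e₀ (C.Φ θb τ)).1 < baseCoord γ e₀) :
    IsCompact (F.leaf (vert γ e₀ τ)) := by
  by_contra hK
  haveI : NoncompactSpace (F.Leaf (vert γ e₀ τ)) := noncompactSpace_leaf_of_not_isCompact hK
  have he₀ := C.box_mem
  -- the horizontal as a path in the leaf of `p = V τ`
  set y : X := vert γ e₀ τ with hy
  let h : I → F.Leaf y := fun θ ↦ ⟨toLeafSpace (C.Φ θ τ), C.Φ_mem_leaf hτ θ⟩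
  have hc : Continuous h := (C.continuous_toLeafSpace_Φ hτ).subtype_mk _
  let p : F.Leaf y := Leaf.mk y (F.mem_leaf_self y)
  -- the leaf arc of the plaque through `p`
  have hyp : y ∈ plaque e₀ τ := vert_mem_plaque he₀ τ
  have hP : plaque e₀ τ ⊆ F.leaf y := F.plaque_subset_leaf_of_mem he₀ (F.mem_leaf_self y) hyp
  have hpa : p ∈ (leafArc e₀ τ hP he₀).source := (mem_leafArc_source_iff hP he₀).2 hyp
  have hθa : h θa ∈ (leafArc e₀ τ hP he₀).source := (mem_leafArc_source_iff hP he₀).2 ha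
  have hθb : h θb ∈ (leafArc e₀ τ hP he₀).source := (mem_leafArc_source_iff hP he₀).2 hb
  have hcp : leafArc e₀ τ hP he₀ p = baseCoord γ e₀ := by
    rw [leafArc_apply hP he₀ hpa]
    show (e₀ (vert γ e₀ τ)).1 = baseCoord γ e₀
    rw [apply_vert he₀]
  -- `p < h θa` and `h θb < p` in the leaf order
  have h_after : leafLT hbi p (h θa) := by
    rw [← leafArc_lt_iff he₀ hP hpa hθa, hcp, leafArc_apply hP he₀ hθa]
    exact hgt
  have h_before : leafLT hbi (h θb) p := by
    rw [← leafArc_lt_iff he₀ hP hθb hpa, hcp, leafArc_apply hP he₀ hθb]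
    exact hlt
  -- on the parameter interval between `θa` and `θb` the path avoids `p`
  have hne : ∀ θ ∈ uIcc θa θb, h θ ≠ p := fun θ hθ heq ↦
    hav θ hθ (congrArg (fun q : F.Leaf y ↦ ofLeafSpace (q : F.LeafSpace)) heq)
  -- pull back to the real line and use connectedness of the interval
  let H : ℝ → F.Leaf y := h ∘ projIcc 0 1 zero_le_one
  have hH : Continuous H := hc.comp continuous_projIcc
  have hHθ : ∀ θ : I, H θ = h θ := fun θ ↦ by
    show h (projIcc 0 1 zero_le_one (θ : ℝ)) = h θ
    rw [projIcc_val]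
  set Sgt : Set ℝ := H ⁻¹' {q | leafLT hbi p q} with hSgt
  set Slt : Set ℝ := H ⁻¹' {q | leafLT hbi q p} with hSlt
  have hSgto : IsOpen Sgt := (isOpen_setOf_leafLT_right p).preimage hH
  have hSlto : IsOpen Slt := (isOpen_setOf_leafLT_left p).preimage hH
  have hcover : uIcc (θa : ℝ) (θb : ℝ) ⊆ Sgt ∪ Slt := by
    intro s hs
    have hs01 : s ∈ Icc (0 : ℝ) 1 := by
      rcases mem_uIcc.1 hs with ⟨h₁, h₂⟩ | ⟨h₁, h₂⟩
      · exact ⟨θa.2.1.trans h₁, h₂.trans θb.2.2⟩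
      · exact ⟨θb.2.1.trans h₁, h₂.trans θa.2.2⟩
    have hθ : (⟨s, hs01⟩ : I) ∈ uIcc θa θb := by
      rcases mem_uIcc.1 hs with ⟨h₁, h₂⟩ | ⟨h₁, h₂⟩
      · exact mem_uIcc.2 (Or.inl ⟨h₁, h₂⟩)
      · exact mem_uIcc.2 (Or.inr ⟨h₁, h₂⟩)
    have hHs : H s = h ⟨s, hs01⟩ := by
      show h (projIcc 0 1 zero_le_one s) = h ⟨s, hs01⟩
      rw [projIcc_of_mem _ hs01]
    rcases leafLT_trichotomy (hbi := hbi) p (H s) with hlt' | heq | hgt'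
    · exact Or.inl hlt'
    · exact (hne _ hθ (by rw [← hHs]; exact heq.symm)).elim
    · exact Or.inr hgt'
  have hneg : (uIcc (θa : ℝ) (θb : ℝ) ∩ Sgt).Nonempty :=
    ⟨θa, left_mem_uIcc, by show leafLT hbi p (H θa); rw [hHθ]; exact h_after⟩
  have hnel : (uIcc (θa : ℝ) (θb : ℝ) ∩ Slt).Nonempty :=
    ⟨θb, right_mem_uIcc, by show leafLT hbi (H θb) p; rw [hHθ]; exact h_before⟩
  obtain ⟨s, -, hsg, hsl⟩ := isPreconnected_uIcc Sgt Slt hSgto hSlto hcover hneg hnel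
  exact leafLT_asymm hsg hsl

/-- **Two arcs leaving a point along a line in the same direction must cross** (real
intermediate value lemma used for the sides of an injective loop): if `v` is continuous on
`[0, t]` and on `[1 - t, 1]` with `v 0 = v 1 = b₀`, `v t > b₀`, `v (1 - t) > b₀`, then some
`s ∈ [0, t]` and `s' ∈ [1 - t, 1)` have `v s = v s'`. [folklore] -/
theorem exists_eq_of_same_side {v : ℝ → ℝ} {b₀ t : ℝ} (ht₀ : 0 ≤ t) (ht₁ : 1 - t ≤ 1)
    (hc₀ : ContinuousOn v (Icc 0 t)) (hc₁ : ContinuousOn v (Icc (1 - t) 1)) (hv₀ : v 0 = b₀)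
    (hv₁ : v 1 = b₀) (hpos : b₀ < v t) (hpos' : b₀ < v (1 - t)) :
    ∃ s ∈ Icc 0 t, ∃ s' ∈ Ico (1 - t) 1, v s = v s' := by
  set m := min (v t) (v (1 - t)) with hm
  have hbm : b₀ < m := lt_min hpos hpos'
  obtain ⟨s, hs, hvs⟩ : m ∈ v '' Icc 0 t :=
    intermediate_value_Icc ht₀ hc₀ ⟨by rw [hv₀]; exact hbm.le, min_le_left _ _⟩
  obtain ⟨s', hs', hvs'⟩ : m ∈ v '' Icc (1 - t) 1 :=
    intermediate_value_Icc' ht₁ hc₁ ⟨by rw [hv₁]; exact hbm.le, min_le_right _ _⟩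
  have hs'1 : s' ≠ 1 := by
    rintro rfl
    rw [hv₁] at hvs'
    exact hbm.ne hvs'
  exact ⟨s, hs, s', ⟨hs'.1, lt_of_le_of_ne hs'.2 hs'1⟩, hvs.trans hvs'.symm⟩

/-- **The ends of an injective loop leave its base point on opposite sides** (in a chart in
which the loop near its base point runs on one line, with coordinate `v`): if `v` is
continuous on `[0, t]` and `[1 - t, 1]` (`0 < t < 1 - t`), `v 0 = v 1 = b₀`, and `v` takes
distinct values at distinct parameters of `[0, t] ∪ [1 - t, 1)`, then `v t - b₀` and
`v (1 - t) - b₀` have opposite signs. [folklore] -/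
theorem mul_neg_of_injective_ends {v : ℝ → ℝ} {b₀ t : ℝ} (ht₀ : 0 < t) (ht : t < 1 - t) (ht₁ : 1 - t < 1)
    (hc₀ : ContinuousOn v (Icc 0 t)) (hc₁ : ContinuousOn v (Icc (1 - t) 1)) (hv₀ : v 0 = b₀)
    (hv₁ : v 1 = b₀)
    (hinj : ∀ s ∈ Icc 0 t ∪ Ico (1 - t) 1, ∀ s' ∈ Icc 0 t ∪ Ico (1 - t) 1, v s = v s' → s = s') :
    (v t - b₀) * (v (1 - t) - b₀) < 0 := by
  have htm : t ∈ Icc 0 t ∪ Ico (1 - t) 1 := Or.inl ⟨ht₀.le, le_rfl⟩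
  have h0m : (0 : ℝ) ∈ Icc 0 t ∪ Ico (1 - t) 1 := Or.inl ⟨le_rfl, ht₀.le⟩
  have h1m : 1 - t ∈ Icc 0 t ∪ Ico (1 - t) 1 := Or.inr ⟨le_rfl, ht₁⟩
  have hvt : v t ≠ b₀ := fun h ↦ by
    have := hinj t htm 0 h0m (h.trans hv₀.symm)
    linarith
  have hv1t : v (1 - t) ≠ b₀ := fun h ↦ by
    have := hinj (1 - t) h1m 0 h0m (h.trans hv₀.symm)
    linarith
  -- same side is impossible, for `v` and for `-v`
  have key : ∀ w : ℝ → ℝ, ContinuousOn w (Icc 0 t) → ContinuousOn w (Icc (1 - t) 1) →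
      (∀ s ∈ Icc 0 t ∪ Ico (1 - t) 1, ∀ s' ∈ Icc 0 t ∪ Ico (1 - t) 1, w s = w s' → s = s') →
      ∀ c : ℝ, w 0 = c → w 1 = c → c < w t → c < w (1 - t) → False := by
    intro w hw₀ hw₁ hwinj c hc0 hc1 h₁ h₂
    obtain ⟨s, hs, s', hs', heq⟩ := exists_eq_of_same_side ht₀.le ht₁.le hw₀ hw₁ hc0 hc1 h₁ h₂
    have hss' := hwinj s (Or.inl hs) s' (Or.inr hs') heq
    rw [hss'] at hs
    linarith [hs.2, hs'.1]
  rcases lt_or_gt_of_ne hvt with h₁ | h₁ <;> rcases lt_or_gt_of_ne hv1t with h₂ | h₂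
  · exfalso
    refine key (fun s ↦ -v s) hc₀.neg hc₁.neg (fun s hs s' hs' h ↦ hinj s hs s' hs' (neg_injective h))
      (-b₀) (by rw [hv₀]) (by rw [hv₁]) (by linarith) (by linarith)
  · exact mul_neg_of_neg_of_pos (by linarith) (by linarith)
  · exact mul_neg_of_pos_of_neg (by linarith) (by linarith)
  · exfalso
    exact key v hc₀ hc₁ hinj b₀ hv₀ hv₁ h₁ h₂

namespace ClosedFence

/-- **The constants of the order argument.** For a closed fence `C` over the injective leaf
loop `γ` there are a parameter `θ₁ ∈ (0, 1/2)`, a sign `σ ≠ 0` and a level radius `δ` such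
that for every level `τ` with `|τ - τ₀| < δ`: (a) on `[0, θ₁] ∪ [1 - θ₁, 1]` the horizontal
`Φ(·, τ)` runs on the plaque of `e₀` at height `τ` (the fence levels in `e₀` near both ends,
`exists_nhds_forall_mem_plaque`); (b) on `[θ₁, 1 - θ₁]` it avoids the point `V τ` of the
vertical (compactness: at the base level the loop avoids the base point there, and `V τ → γ 0`);
(c) at `θ₁` its leaf coordinate lies on the side `σ` of `b₀` and at `1 - θ₁` on the side `-σ`
(continuity in `τ`; at the base level these are the two ends of the injective loop `γ`, which
leave `γ 0` on opposite sides, `mul_neg_of_injective_ends`). [folklore] -/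
theorem exists_constants [T2Space X] (C : ClosedFence γ e₀) :
    ∃ θ₁ : I, 0 < (θ₁ : ℝ) ∧ (θ₁ : ℝ) < 1 / 2 ∧ ∃ sg : ℝ, sg ≠ 0 ∧ ∃ δ > (0 : ℝ), δ ≤ C.ε ∧
      ∀ τ ∈ Ioo (baseLevel γ e₀ - δ) (baseLevel γ e₀ + δ),
        (∀ θ : I, (θ : ℝ) ≤ θ₁ ∨ 1 - θ₁ ≤ (θ : ℝ) → C.Φ θ τ ∈ plaque e₀ τ) ∧
        (∀ θ : I, (θ₁ : ℝ) ≤ θ → (θ : ℝ) ≤ 1 - θ₁ → C.Φ θ τ ≠ vert γ e₀ τ) ∧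
        0 < sg * ((e₀ (C.Φ θ₁ τ)).1 - baseCoord γ e₀) ∧
        sg * ((e₀ (C.Φ (unitInterval.symm θ₁) τ)).1 - baseCoord γ e₀) < 0 := by
  have he₀ := C.box_mem
  have hx₀ := C.base_mem
  set τ₀ : ℝ := baseLevel γ e₀ with hτ₀def
  set b₀ : ℝ := baseCoord γ e₀ with hb₀def
  have hτ₀I : τ₀ ∈ Ioo (τ₀ - C.ε) (τ₀ + C.ε) := C.baseLevel_mem_Ioo
  -- (A) the fence levels in `e₀` near both ends
  obtain ⟨U₀, hU₀, δ₀, hδ₀, hδ₀ε, hA₀⟩ := exists_nhds_forall_mem_plaque C.Γ he₀ hx₀ C.apply_zero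
    C.ε_pos C.isFenceOn
  obtain ⟨U₁, hU₁, δ₁, hδ₁, hδ₁ε, hA₁⟩ := exists_nhds_forall_mem_plaque C.Γ he₀ hx₀ C.apply_one
    C.ε_pos C.isFenceOn
  change ∀ a ∈ U₀, ∀ τ ∈ Ioo (τ₀ - δ₀) (τ₀ + δ₀), C.Φ a τ ∈ plaque e₀ τ at hA₀
  change ∀ a ∈ U₁, ∀ τ ∈ Ioo (τ₀ - δ₁) (τ₀ + δ₁), C.Φ a τ ∈ plaque e₀ τ at hA₁
  -- (B) the parameter `θ₁ = t`
  obtain ⟨r₀, hr₀, hball₀⟩ := Metric.mem_nhds_iff.1 hU₀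
  obtain ⟨r₁, hr₁, hball₁⟩ := Metric.mem_nhds_iff.1 hU₁
  set t : ℝ := min (min r₀ r₁) (1 / 3) / 2 with htdef
  have ht₀ : 0 < t := by positivity
  have htr₀ : t < r₀ := by
    have : min (min r₀ r₁) (1 / 3) ≤ r₀ := (min_le_left _ _).trans (min_le_left _ _)
    rw [htdef]; linarith
  have htr₁ : t < r₁ := by
    have : min (min r₀ r₁) (1 / 3) ≤ r₁ := (min_le_left _ _).trans (min_le_right _ _)
    rw [htdef]; linarith
  have ht6 : t ≤ 1 / 6 := by
    have : min (min r₀ r₁) (1 / 3) ≤ 1 / 3 := min_le_right _ _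
    rw [htdef]; linarith
  have ht₁ : t < 1 := by linarith
  have hthalf : t < 1 / 2 := by linarith
  set θ₁ : I := ⟨t, ht₀.le, ht₁.le⟩ with hθ₁def
  -- parameters near the ends lie in `U₀`, `U₁`
  have hmemU₀ : ∀ θ : I, (θ : ℝ) ≤ t → θ ∈ U₀ := fun θ hθ ↦ hball₀ (by
    rw [Metric.mem_ball, Subtype.dist_eq, Real.dist_eq, show ((0 : I) : ℝ) = 0 from rfl, sub_zero,
      abs_of_nonneg θ.2.1]
    linarith)
  have hmemU₁ : ∀ θ : I, 1 - t ≤ (θ : ℝ) → θ ∈ U₁ := fun θ hθ ↦ hball₁ (by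
    rw [Metric.mem_ball, Subtype.dist_eq, Real.dist_eq, show ((1 : I) : ℝ) = 1 from rfl,
      abs_sub_comm, abs_of_nonneg (by linarith [θ.2.2])]
    linarith [θ.2.2])
  -- (C) the two ends of the loop leave the base point on opposite sides of the plaque
  set v : ℝ → ℝ := fun s ↦ (e₀ (ofLeafSpace ((γ s : F.Leaf x) : F.LeafSpace))).1 with hvdef
  have hcγ : Continuous fun s : ℝ ↦ ofLeafSpace ((γ s : F.Leaf x) : F.LeafSpace) :=
    F.continuous_ofLeafSpace.comp (continuous_subtype_val.comp C.cont)
  have hplaque₀ : ∀ s (hs : s ∈ Icc (0 : ℝ) 1), s ≤ t ∨ 1 - t ≤ s →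
      ofLeafSpace ((γ s : F.Leaf x) : F.LeafSpace) ∈ plaque e₀ τ₀ := by
    intro s hs hst
    have h := C.Φ_baseLevel ⟨s, hs⟩
    rw [loopPath_apply] at h
    rw [← h]
    rcases hst with hst | hst
    · exact hA₀ _ (hmemU₀ ⟨s, hs⟩ hst) τ₀ ⟨by linarith, by linarith⟩
    · exact hA₁ _ (hmemU₁ ⟨s, hs⟩ hst) τ₀ ⟨by linarith, by linarith⟩
  have hcv : ∀ a b : ℝ, (∀ s ∈ Icc a b, ofLeafSpace ((γ s : F.Leaf x) : F.LeafSpace) ∈ plaque e₀ τ₀) →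
      ContinuousOn v (Icc a b) := fun a b hab ↦
    continuous_fst.comp_continuousOn (e₀.continuousOn.comp hcγ.continuousOn fun s hs ↦ (hab s hs).1)
  have hc₀ : ContinuousOn v (Icc 0 t) :=
    hcv 0 t fun s hs ↦ hplaque₀ s ⟨hs.1, hs.2.trans ht₁.le⟩ (Or.inl hs.2)
  have hc₁ : ContinuousOn v (Icc (1 - t) 1) :=
    hcv (1 - t) 1 fun s hs ↦ hplaque₀ s ⟨by linarith [hs.1], hs.2⟩ (Or.inr hs.1)
  have hv₀ : v 0 = b₀ := rfl
  have hv₁ : v 1 = b₀ := by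
    show (e₀ (ofLeafSpace ((γ 1 : F.Leaf x) : F.LeafSpace))).1 = b₀
    rw [show (1 : ℝ) = 0 + 1 by ring, C.per 0]
    rfl
  have hinjv : ∀ s ∈ Icc 0 t ∪ Ico (1 - t) 1, ∀ s' ∈ Icc 0 t ∪ Ico (1 - t) 1, v s = v s' → s = s' := by
    have hmem : ∀ s ∈ Icc 0 t ∪ Ico (1 - t) 1, s ∈ Ico (0 : ℝ) 1 ∧
        ofLeafSpace ((γ s : F.Leaf x) : F.LeafSpace) ∈ plaque e₀ τ₀ := by
      rintro s (hs | hs)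
      · exact ⟨⟨hs.1, hs.2.trans_lt ht₁⟩, hplaque₀ s ⟨hs.1, hs.2.trans ht₁.le⟩ (Or.inl hs.2)⟩
      · exact ⟨⟨by linarith [hs.1], hs.2⟩, hplaque₀ s ⟨by linarith [hs.1], hs.2.le⟩ (Or.inr hs.1)⟩
    intro s hs s' hs' heq
    obtain ⟨hsI, hsP⟩ := hmem s hs
    obtain ⟨hs'I, hs'P⟩ := hmem s' hs'
    have hpt : e₀ (ofLeafSpace ((γ s : F.Leaf x) : F.LeafSpace)) =
        e₀ (ofLeafSpace ((γ s' : F.Leaf x) : F.LeafSpace)) :=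
      Prod.ext heq (hsP.2.trans hs'P.2.symm)
    have hpt' := e₀.injOn hsP.1 hs'P.1 hpt
    exact C.inj hsI hs'I (Subtype.ext ((ofLeafSpace (F := F)).injective hpt'))
  have hsides : (v t - b₀) * (v (1 - t) - b₀) < 0 :=
    mul_neg_of_injective_ends ht₀ (by linarith) (by linarith) hc₀ hc₁ hv₀ hv₁ hinjv
  set sg : ℝ := v t - b₀ with hσdef
  have hσ : sg ≠ 0 := fun h ↦ by rw [h, zero_mul] at hsides; exact lt_irrefl _ hsides
  -- (D) on the middle interval the horizontals avoid the vertical, uniformly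
  set J : Set I := {θ | t ≤ (θ : ℝ) ∧ (θ : ℝ) ≤ 1 - t} with hJdef
  have hJ : IsCompact J :=
    ((isClosed_le continuous_const continuous_subtype_val).inter
      (isClosed_le continuous_subtype_val continuous_const)).isCompact
  have hev : ∀ᶠ τ in 𝓝 τ₀, ∀ θ ∈ J, C.Φ θ τ ≠ vert γ e₀ τ := by
    refine hJ.eventually_forall_of_forall_eventually fun θ hθ ↦ ?_
    have h₁ : ContinuousAt (fun z : ℝ × I ↦ C.Φ z.2 z.1) (τ₀, θ) :=
      ContinuousAt.comp_of_eq (C.continuousAt_uncurry_Φ θ) continuous_swap.continuousAt rfl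
    have h₂ : ContinuousAt (fun z : ℝ × I ↦ vert γ e₀ z.1) (τ₀, θ) :=
      ((continuous_vert he₀).comp continuous_fst).continuousAt
    have h₃ := h₁.prodMk h₂
    have hval : (C.Φ θ τ₀, vert γ e₀ τ₀) ∈ (diagonal X)ᶜ := by
      show C.Φ θ τ₀ ≠ vert γ e₀ τ₀
      rw [C.Φ_baseLevel, vert_baseLevel hx₀]
      exact loopPath_ne_base γ C.cont C.per C.inj (ht₀.trans_le hθ.1) (hθ.2.trans_lt (by linarith))
    exact Filter.eventually_of_mem (h₃.preimage_mem_nhds (isClosed_diagonal.isOpen_compl.mem_nhds hval))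
      fun z hz ↦ hz
  obtain ⟨δ₂, hδ₂, hδ₂sub⟩ := IsHomeoGermAt.exists_Ioo_subset_of_mem_nhds hev
  -- (E) the sides persist for nearby levels
  have hcoord : ∀ θ : I, (θ : ℝ) ≤ t ∨ 1 - t ≤ (θ : ℝ) →
      ContinuousAt (fun τ ↦ (e₀ (C.Φ θ τ)).1) τ₀ := fun θ hθ ↦ by
    have hsrc : C.Φ θ τ₀ ∈ e₀.source := by
      rw [C.Φ_baseLevel, loopPath_apply]
      exact (hplaque₀ θ θ.2 hθ).1
    exact continuous_fst.continuousAt.comp ((e₀.continuousAt hsrc).comp (C.continuousAt_Φ θ))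
  have hval₁ : (e₀ (C.Φ θ₁ τ₀)).1 - b₀ = sg := by rw [C.Φ_baseLevel, loopPath_apply]
  have hval₂ : (e₀ (C.Φ (unitInterval.symm θ₁) τ₀)).1 - b₀ = v (1 - t) - b₀ := by
    rw [C.Φ_baseLevel, loopPath_apply, coe_symm_eq]
  have hevA : ∀ᶠ τ in 𝓝 τ₀, 0 < sg * ((e₀ (C.Φ θ₁ τ)).1 - b₀) := by
    have hc : ContinuousAt (fun τ ↦ sg * ((e₀ (C.Φ θ₁ τ)).1 - b₀)) τ₀ :=
      continuousAt_const.mul ((hcoord θ₁ (Or.inl le_rfl)).sub continuousAt_const)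
    refine hc.eventually (lt_mem_nhds ?_)
    show 0 < sg * ((e₀ (C.Φ θ₁ τ₀)).1 - b₀)
    rw [hval₁]
    exact mul_self_pos.2 hσ
  have hevB : ∀ᶠ τ in 𝓝 τ₀, sg * ((e₀ (C.Φ (unitInterval.symm θ₁) τ)).1 - b₀) < 0 := by
    have hc : ContinuousAt (fun τ ↦ sg * ((e₀ (C.Φ (unitInterval.symm θ₁) τ)).1 - b₀)) τ₀ :=
      continuousAt_const.mul ((hcoord _ (Or.inr (by rw [coe_symm_eq]))).sub continuousAt_const)
    refine hc.eventually (gt_mem_nhds ?_)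
    show sg * ((e₀ (C.Φ (unitInterval.symm θ₁) τ₀)).1 - b₀) < 0
    rw [hval₂]
    exact hsides
  obtain ⟨δ₃, hδ₃, hδ₃sub⟩ := IsHomeoGermAt.exists_Ioo_subset_of_mem_nhds (hevA.and hevB)
  -- (F) assemble
  set δ : ℝ := min (min δ₀ δ₁) (min δ₂ δ₃) with hδdef
  have hδ : 0 < δ := lt_min (lt_min hδ₀ hδ₁) (lt_min hδ₂ hδ₃)
  have hδ₀' : δ ≤ δ₀ := (min_le_left _ _).trans (min_le_left _ _)
  have hδ₁' : δ ≤ δ₁ := (min_le_left _ _).trans (min_le_right _ _)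
  have hδ₂' : δ ≤ δ₂ := (min_le_right _ _).trans (min_le_left _ _)
  have hδ₃' : δ ≤ δ₃ := (min_le_right _ _).trans (min_le_right _ _)
  have hsub : ∀ {d : ℝ}, δ ≤ d → Ioo (τ₀ - δ) (τ₀ + δ) ⊆ Ioo (τ₀ - d) (τ₀ + d) := fun h ↦
    Ioo_subset_Ioo (by linarith) (by linarith)
  refine ⟨θ₁, ht₀, hthalf, sg, hσ, δ, hδ, hδ₀'.trans hδ₀ε, fun τ hτ ↦ ⟨fun θ hθ ↦ ?_, fun θ h₁ h₂ ↦ ?_, ?_, ?_⟩⟩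
  · rcases hθ with hθ | hθ
    · exact hA₀ θ (hmemU₀ θ hθ) τ (hsub hδ₀' hτ)
    · exact hA₁ θ (hmemU₁ θ hθ) τ (hsub hδ₁' hτ)
  · exact hδ₂sub (hsub hδ₂' hτ) θ ⟨h₁, h₂⟩
  · exact (hδ₃sub (hsub hδ₃' hτ)).1
  · exact (hδ₃sub (hsub hδ₃' hτ)).2

/-- **Local stability of a compact leaf with trivial holonomy (planar foliations).** For a
closed fence `C` over the injective leaf loop `γ` of a bi-oriented planar foliation (from
`exists_closedFence`: the leaf of `γ` compact with trivial holonomy along `γ`), **every leaf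
through a point `V τ` of the vertical of `e₀` through `γ 0` near the base level is compact**:
the band of closed leaves around a closed orbit of trivial holonomy (Camacho–Lins Neto, Ch. IV
§2 Thm. 3; Ch. VII §2 Prop. 1, the openness of the regions `Vᵢ`; Hector–Hirsch A, Ch. III
2.1.8). [cite: CamachoLinsNeto1985, Ch. IV §2 Thm. 3] -/
theorem exists_forall_isCompact_leaf [T2Space X] [SecondCountableTopology X] (hbi : IsBiOriented F)
    (C : ClosedFence γ e₀) :
    ∃ δ > (0 : ℝ), δ ≤ C.ε ∧ ∀ τ ∈ Ioo (baseLevel γ e₀ - δ) (baseLevel γ e₀ + δ),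
      IsCompact (F.leaf (vert γ e₀ τ)) := by
  obtain ⟨θ₁, hθ₀, hθhalf, sg, hσ, δ, hδ, hδε, H⟩ := C.exists_constants
  refine ⟨δ, hδ, hδε, fun τ hτ ↦ ?_⟩
  obtain ⟨hpl, hav, hA, hB⟩ := H τ hτ
  have hτε : τ ∈ Ioo (baseLevel γ e₀ - C.ε) (baseLevel γ e₀ + C.ε) :=
    Ioo_subset_Ioo (by linarith) (by linarith) hτ
  have hle : θ₁ ≤ unitInterval.symm θ₁ := by
    show (θ₁ : ℝ) ≤ (unitInterval.symm θ₁ : ℝ)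
    rw [coe_symm_eq]
    linarith
  have hsymm : 1 - (θ₁ : ℝ) ≤ (unitInterval.symm θ₁ : ℝ) := by rw [coe_symm_eq]
  have havI : ∀ θ ∈ Icc θ₁ (unitInterval.symm θ₁), C.Φ θ τ ≠ vert γ e₀ τ := fun θ hθ ↦ by
    refine hav θ hθ.1 ?_
    have h : (θ : ℝ) ≤ (unitInterval.symm θ₁ : ℝ) := Subtype.coe_le_coe.mpr hθ.2
    rwa [coe_symm_eq] at h
  rcases lt_or_gt_of_ne hσ with hneg | hpos
  · -- `sg < 0`: the horizontal is after `p` at `1 - θ₁` and before `p` at `θ₁`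
    have hafter : baseCoord γ e₀ < (e₀ (C.Φ (unitInterval.symm θ₁) τ)).1 := by
      have := pos_of_mul_neg_right hB hneg.le
      linarith
    have hbefore : (e₀ (C.Φ θ₁ τ)).1 < baseCoord γ e₀ := by
      have := neg_of_mul_pos_right hA hneg.le
      linarith
    refine isCompact_leaf_of_sides hbi C hτε (hpl _ (Or.inr hsymm)) (hpl _ (Or.inl le_rfl)) ?_
      hafter hbefore
    intro θ hθ
    rw [uIcc_comm, uIcc_of_le hle] at hθ
    exact havI θ hθ
  · -- `sg > 0`: the horizontal is after `p` at `θ₁` and before `p` at `1 - θ₁`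
    have hafter : baseCoord γ e₀ < (e₀ (C.Φ θ₁ τ)).1 := by
      have := pos_of_mul_pos_right hA hpos.le
      linarith
    have hbefore : (e₀ (C.Φ (unitInterval.symm θ₁) τ)).1 < baseCoord γ e₀ := by
      have := neg_of_mul_neg_right hB hpos.le
      linarith
    refine isCompact_leaf_of_sides hbi C hτε (hpl _ (Or.inl le_rfl)) (hpl _ (Or.inr hsymm)) ?_
      hafter hbefore
    intro θ hθ
    rw [uIcc_of_le hle] at hθ
    exact havI θ hθ

end ClosedFence

end Order

end Literature.Topology.PlanarFoliations
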